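import Literature.MathematicalPhysics.KineticTheory.HardSphereEulerPrimitiveForm
import Literature.Analysis.FunctionSpaces.TorusSupNormContinuity
import Literature.Analysis.FunctionSpaces.TorusLiftDerivBounds
import Literature.Analysis.FunctionSpaces.TorusDerivBounds
import HarnessLib

/-!
# Level energies of the `H³` stability estimate for the hard-sphere Euler system on `𝕋³`:
# definitions, regularity, and the lift-to-torus bridge

MathematicalPhysics/KineticTheory support file of LAYER 4 (the fixed-horizon a-priori `H³`
stability estimate, T. Kato, ARMA 58 (1975) §§3–4 / A. Majda 1984, Ch. 2, proof of Thms 2.1–2.2)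
of the proof of `hsEuler_continuousDependence` (`HardSphereEulerContinuousDependenceProofs.lean`).
A `σ`-solution `(ρ, u, θ)` of the hard-sphere Euler system with pressure law `ρ θ ζ(ρ)` is
compared with a reference solution `(ρ₁, u₁, θ₁)`; the difference `δV = (δρ, δu, δθ)` is measured
in the WEIGHTED `L²` energies of its spatial derivatives of order `k ≤ 3`, with the Friedrichs
weights of the `σ`-solution `A = θ γ(ρ)/ρ` (`γ = ζ + ρ ζ'`), `ρ`, `B = 3ρ/(2θ)`. Contents
(namespace `HsEulerStability`):

* DEFINITIONS (real-valued, with bodies): `shadowWeightA`, `shadowWeightB` — the weights;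
  `shadowE0 … shadowE3` — the level energies `E_k(s) = ∫_{𝕋³} e_k(s, x) dx`, `e_k` the sum over
  ordered multi-indices of length `k` of `½ (A (∂^α δρ)² + ρ ‖∂^α δu‖² + B (∂^α δθ)²)`
  (outermost derivative = outermost sum; nesting `Torus.partialDeriv j (Torus.partialDeriv i ·)`);
* REGULARITY: `isSmoothSpaceTimeOn_shadowDensity0 … 3`, `isSmoothSpaceTimeOn_shadowE0_integrand …`,
  `isSmoothSpaceTimeOn_shadowWeightA/B` (the densities are jointly smooth on `[0, T) × 𝕋³`),
  `continuousOn_shadowE0 … 3` (`E_k` is continuous on `[0, T)`), `shadow_sup_continuous(_vec)`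
  (the sup norm of a jointly smooth field is continuous in time) — the inputs of the Grönwall
  shell `HsEulerCalc.torus_energy_le_of_balance` and of the bootstrap
  `HsEulerCalc.bootstrap_of_continuousOn` (`HardSphereEulerEnergyShell.lean`);
* LIFT → TORUS BRIDGE: `torus_norm_iteratedFDeriv_lift_partialDeriv_le` (shift lemma
  `‖Dᵏ((∂ᵢf)∘proj)‖ ≤ ‖Dᵏ⁺¹(f∘proj)‖`), its iterate, and `torus_partialDeriv_iter_le_of_lift_bounds(_vec)`
  — `Cᵏ` sup bounds of periodic lifts (the data hypothesis of `hsEuler_continuousDependence`)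
  bound the nested torus partial derivatives of orders `≤ 4`;
Ported from the summit-side files `Summits/AtomisticToContinuum/HydrodynamicLimit/Theorems/
ImplosionDichotomyPolynomialCompression{ShadowingDefs (real-valued definitions only),
ShadowRegularity,ReferenceJets (§1)}.lean` (Literature may not import
Summits, CONVENTIONS §2; names verbatim inside `HsEulerStability`, not opened by the summit files).

## Mathlib / tree search

Tree: `Torus.IsSmoothSpaceTimeOn.{partialDeriv, continuousOn_integral, continuousOn_toReal_eSupNorm}`,
`Torus.norm_le_toReal_eSupNorm` (`TorusSupNormContinuity.lean`), `Torus.lift_lineDeriv`,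
`Torus.iterPartialDeriv` (`TorusLiftDerivBounds.lean`). Mathlib: `norm_iteratedFDeriv_clm_apply_const`,
`norm_iteratedFDeriv_fderiv`, `ContinuousLinearMap.norm_iteratedFDeriv_comp_left`.

## References

* T. Kato, *The Cauchy problem for quasi-linear symmetric hyperbolic systems*, Arch. Rational
  Mech. Anal. 58 (1975) 181–205, §§3–4. [`Kato1975`]
* A. Majda, *Compressible Fluid Flow and Systems of Conservation Laws in Several Space
  Variables*, Appl. Math. Sci. 53, Springer 1984: Ch. 2, §2.1, proof of Thm 2.1. [`Majda1984`]
-/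

noncomputable section

open Set Filter MeasureTheory
open _root_.Topology
open scoped ContDiff ENNReal

namespace Literature.MathematicalPhysics.KineticTheory

open Literature.Analysis.FunctionSpaces
open HsEulerCalc

namespace HsEulerStability

/-! ## The weights and the level energies (definitions) -/

/-- The Friedrichs weight of the density component at the σ-solution: `A = θ (ζ(ρ) + ρ ζ'(ρ)) / ρ`
(`= ∂_ρ p / ρ`). [folklore] -/
def shadowWeightA (ζ : ℝ → ℝ) (ρ θ : ℝ → T3 → ℝ) (s : ℝ) (x : T3) : ℝ :=
  θ s x * (ζ (ρ s x) + ρ s x * deriv ζ (ρ s x)) / ρ s x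

/-- The Friedrichs weight of the temperature component at the σ-solution: `B = 3ρ/(2θ)`. [folklore] -/
def shadowWeightB (ρ θ : ℝ → T3 → ℝ) (s : ℝ) (x : T3) : ℝ :=
  3 / 2 * ρ s x / θ s x

/-- Level-0 weighted energy `E₀(s) = ∫ ½(A δρ² + ρ |δu|² + B δθ²)` of the difference of the σ-solution
`(ρ, u, θ)` and the reference `(ρ₁, u₁, θ₁)`. [folklore] -/
def shadowE0 (ζ : ℝ → ℝ) (ρ θ : ℝ → T3 → ℝ) (u : ℝ → T3 → V3) (ρ₁ θ₁ : ℝ → T3 → ℝ)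
    (u₁ : ℝ → T3 → V3) (s : ℝ) : ℝ :=
  ∫ x, 1 / 2 * (shadowWeightA ζ ρ θ s x * (ρ s x - ρ₁ s x) ^ 2 + ρ s x * ‖u s x - u₁ s x‖ ^ 2 +
    shadowWeightB ρ θ s x * (θ s x - θ₁ s x) ^ 2)

/-- Level-1 weighted energy `E₁(s) = Σₗ ∫ ½(A (∂ₗδρ)² + ρ |∂ₗδu|² + B (∂ₗδθ)²)`. [folklore] -/
def shadowE1 (ζ : ℝ → ℝ) (ρ θ : ℝ → T3 → ℝ) (u : ℝ → T3 → V3) (ρ₁ θ₁ : ℝ → T3 → ℝ)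
    (u₁ : ℝ → T3 → V3) (s : ℝ) : ℝ :=
  ∫ x, ∑ l : Fin 3, 1 / 2 * (shadowWeightA ζ ρ θ s x * (Torus.partialDeriv l (fun y => ρ s y - ρ₁ s y) x) ^ 2 +
    ρ s x * ‖Torus.partialDeriv l (fun y => u s y - u₁ s y) x‖ ^ 2 +
    shadowWeightB ρ θ s x * (Torus.partialDeriv l (fun y => θ s y - θ₁ s y) x) ^ 2)

/-- Level-2 weighted energy `E₂(s) = Σᵢ Σₗ ∫ ½(A (∂ᵢ∂ₗδρ)² + ρ |∂ᵢ∂ₗδu|² + B (∂ᵢ∂ₗδθ)²)`. [folklore] -/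
def shadowE2 (ζ : ℝ → ℝ) (ρ θ : ℝ → T3 → ℝ) (u : ℝ → T3 → V3) (ρ₁ θ₁ : ℝ → T3 → ℝ)
    (u₁ : ℝ → T3 → V3) (s : ℝ) : ℝ :=
  ∫ x, ∑ i : Fin 3, ∑ l : Fin 3, 1 / 2 *
    (shadowWeightA ζ ρ θ s x *
        (Torus.partialDeriv i (Torus.partialDeriv l (fun y => ρ s y - ρ₁ s y)) x) ^ 2 +
      ρ s x * ‖Torus.partialDeriv i (Torus.partialDeriv l (fun y => u s y - u₁ s y)) x‖ ^ 2 +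
      shadowWeightB ρ θ s x *
        (Torus.partialDeriv i (Torus.partialDeriv l (fun y => θ s y - θ₁ s y)) x) ^ 2)

/-- Level-3 weighted energy `E₃(s) = Σⱼ Σᵢ Σₗ ∫ ½(A (∂ⱼ∂ᵢ∂ₗδρ)² + ρ |∂ⱼ∂ᵢ∂ₗδu|² + B (∂ⱼ∂ᵢ∂ₗδθ)²)`.
[folklore] -/
def shadowE3 (ζ : ℝ → ℝ) (ρ θ : ℝ → T3 → ℝ) (u : ℝ → T3 → V3) (ρ₁ θ₁ : ℝ → T3 → ℝ)
    (u₁ : ℝ → T3 → V3) (s : ℝ) : ℝ :=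
  ∫ x, ∑ j : Fin 3, ∑ i : Fin 3, ∑ l : Fin 3, 1 / 2 *
    (shadowWeightA ζ ρ θ s x *
        (Torus.partialDeriv j (Torus.partialDeriv i (Torus.partialDeriv l (fun y => ρ s y - ρ₁ s y))) x) ^ 2 +
      ρ s x * ‖Torus.partialDeriv j (Torus.partialDeriv i (Torus.partialDeriv l (fun y => u s y - u₁ s y))) x‖ ^ 2 +
      shadowWeightB ρ θ s x *
        (Torus.partialDeriv j (Torus.partialDeriv i (Torus.partialDeriv l (fun y => θ s y - θ₁ s y))) x) ^ 2)

/-! ## Regularity of the level energies -/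

/-! ### Algebra of jointly smooth fields (squares, norm squares, the generic energy term) -/

section Algebra

variable {S : Set ℝ}

/-- Squares of jointly smooth scalar fields are jointly smooth. [folklore] -/
theorem isSmoothSpaceTimeOn_sq {φ : ℝ → T3 → ℝ} (h : Torus.IsSmoothSpaceTimeOn S φ) :
    Torus.IsSmoothSpaceTimeOn S (fun s x => φ s x ^ 2) :=
  ContDiffOn.pow h 2

/-- Norm squares of jointly smooth `V3`-valued fields are jointly smooth. [folklore] -/
theorem isSmoothSpaceTimeOn_norm_sq {w : ℝ → T3 → V3} (h : Torus.IsSmoothSpaceTimeOn S w) :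
    Torus.IsSmoothSpaceTimeOn S (fun s x => ‖w s x‖ ^ 2) :=
  ContDiffOn.norm_sq ℝ h

/-- Constant multiples of jointly smooth scalar fields are jointly smooth. [folklore] -/
theorem isSmoothSpaceTimeOn_const_mul {φ : ℝ → T3 → ℝ} (h : Torus.IsSmoothSpaceTimeOn S φ)
    (c : ℝ) : Torus.IsSmoothSpaceTimeOn S (fun s x => c * φ s x) :=
  contDiffOn_const.mul h

/-- The generic level-energy term `½ (A X² + P ‖W‖² + B Y²)` is jointly smooth when the weights
`A, P, B`, the scalar entries `X, Y` and the vector entry `W` are. [folklore] -/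
theorem isSmoothSpaceTimeOn_energyTerm {A P B X Y : ℝ → T3 → ℝ} {W : ℝ → T3 → V3}
    (hA : Torus.IsSmoothSpaceTimeOn S A) (hP : Torus.IsSmoothSpaceTimeOn S P)
    (hB : Torus.IsSmoothSpaceTimeOn S B) (hX : Torus.IsSmoothSpaceTimeOn S X)
    (hW : Torus.IsSmoothSpaceTimeOn S W) (hY : Torus.IsSmoothSpaceTimeOn S Y) :
    Torus.IsSmoothSpaceTimeOn S
      (fun s x => 1 / 2 * (A s x * X s x ^ 2 + P s x * ‖W s x‖ ^ 2 + B s x * Y s x ^ 2)) :=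
  isSmoothSpaceTimeOn_const_mul
    (((hA.mul (isSmoothSpaceTimeOn_sq hX)).add (hP.mul (isSmoothSpaceTimeOn_norm_sq hW))).add
      (hB.mul (isSmoothSpaceTimeOn_sq hY))) _

end Algebra

/-! ### Joint smoothness of the level densities -/

section Densities

/-- **Level 0.** The density `e₀ = ½ (A δρ² + ρ ‖δu‖² + B δθ²)` of `shadowE0` is jointly smooth on
`[0, T) × 𝕋³`. [folklore] -/
theorem isSmoothSpaceTimeOn_shadowDensity0 :
    ∀ {σ σ₁ T : ℝ} {ρ θ ρ₁ θ₁ : ℝ → T3 → ℝ} {u u₁ : ℝ → T3 → V3} {ζ : ℝ → ℝ} {J : Set ℝ},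
    IsHardSphereEulerSolution σ T ρ u θ → IsHardSphereEulerSolution σ₁ T ρ₁ u₁ θ₁ → IsOpen J →
    ContDiffOn ℝ (⊤ : ℕ∞) ζ J → (∀ t ∈ Ico 0 T, ∀ x, ρ t x ∈ J) →
    Torus.IsSmoothSpaceTimeOn (Ico 0 T) (fun s x => 1 / 2 *
      (θ s x * (ζ (ρ s x) + ρ s x * deriv ζ (ρ s x)) / ρ s x * (ρ s x - ρ₁ s x) ^ 2 +
        ρ s x * ‖u s x - u₁ s x‖ ^ 2 + 3 / 2 * ρ s x / θ s x * (θ s x - θ₁ s x) ^ 2)) := by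
  intro σ σ₁ T ρ θ ρ₁ θ₁ u u₁ ζ J hE hE₁ hJ hζ hρJ
  exact isSmoothSpaceTimeOn_energyTerm (hE.isSmoothSpaceTimeOn_weightA hJ hζ hρJ) hE.smooth_density
    (hE.isSmoothSpaceTimeOn_weightB) (hE.smooth_density.sub hE₁.smooth_density)
    (hE.smooth_velocity.sub hE₁.smooth_velocity) (hE.smooth_temperature.sub hE₁.smooth_temperature)

/-- **Level 1.** The density `e₁ = Σₗ ½ (A (∂ₗδρ)² + ρ ‖∂ₗδu‖² + B (∂ₗδθ)²)` of `shadowE1` is jointly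
smooth on `[0, T) × 𝕋³`. [folklore] -/
theorem isSmoothSpaceTimeOn_shadowDensity1 :
    ∀ {σ σ₁ T : ℝ} {ρ θ ρ₁ θ₁ : ℝ → T3 → ℝ} {u u₁ : ℝ → T3 → V3} {ζ : ℝ → ℝ} {J : Set ℝ},
    IsHardSphereEulerSolution σ T ρ u θ → IsHardSphereEulerSolution σ₁ T ρ₁ u₁ θ₁ → IsOpen J →
    ContDiffOn ℝ (⊤ : ℕ∞) ζ J → (∀ t ∈ Ico 0 T, ∀ x, ρ t x ∈ J) →
    Torus.IsSmoothSpaceTimeOn (Ico 0 T) (fun s x => ∑ l : Fin 3, 1 / 2 *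
      (θ s x * (ζ (ρ s x) + ρ s x * deriv ζ (ρ s x)) / ρ s x *
          (Torus.partialDeriv l (fun y => ρ s y - ρ₁ s y) x) ^ 2 +
        ρ s x * ‖Torus.partialDeriv l (fun y => u s y - u₁ s y) x‖ ^ 2 +
        3 / 2 * ρ s x / θ s x * (Torus.partialDeriv l (fun y => θ s y - θ₁ s y) x) ^ 2)) := by
  intro σ σ₁ T ρ θ ρ₁ θ₁ u u₁ ζ J hE hE₁ hJ hζ hρJ
  have hU : UniqueDiffOn ℝ (Ico (0 : ℝ) T) := uniqueDiffOn_Ico 0 T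
  refine Torus.IsSmoothSpaceTimeOn.sum fun l _ => ?_
  exact isSmoothSpaceTimeOn_energyTerm (hE.isSmoothSpaceTimeOn_weightA hJ hζ hρJ) hE.smooth_density
    (hE.isSmoothSpaceTimeOn_weightB) ((hE.smooth_density.sub hE₁.smooth_density).partialDeriv hU l)
    ((hE.smooth_velocity.sub hE₁.smooth_velocity).partialDeriv hU l)
    ((hE.smooth_temperature.sub hE₁.smooth_temperature).partialDeriv hU l)

/-- **Level 2.** The density `e₂ = Σᵢ Σₗ ½ (A (∂ᵢ∂ₗδρ)² + ρ ‖∂ᵢ∂ₗδu‖² + B (∂ᵢ∂ₗδθ)²)` of `shadowE2`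
is jointly smooth on `[0, T) × 𝕋³`. [folklore] -/
theorem isSmoothSpaceTimeOn_shadowDensity2 :
    ∀ {σ σ₁ T : ℝ} {ρ θ ρ₁ θ₁ : ℝ → T3 → ℝ} {u u₁ : ℝ → T3 → V3} {ζ : ℝ → ℝ} {J : Set ℝ},
    IsHardSphereEulerSolution σ T ρ u θ → IsHardSphereEulerSolution σ₁ T ρ₁ u₁ θ₁ → IsOpen J →
    ContDiffOn ℝ (⊤ : ℕ∞) ζ J → (∀ t ∈ Ico 0 T, ∀ x, ρ t x ∈ J) →
    Torus.IsSmoothSpaceTimeOn (Ico 0 T) (fun s x => ∑ i : Fin 3, ∑ l : Fin 3, 1 / 2 *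
      (θ s x * (ζ (ρ s x) + ρ s x * deriv ζ (ρ s x)) / ρ s x *
          (Torus.partialDeriv i (Torus.partialDeriv l (fun y => ρ s y - ρ₁ s y)) x) ^ 2 +
        ρ s x * ‖Torus.partialDeriv i (Torus.partialDeriv l (fun y => u s y - u₁ s y)) x‖ ^ 2 +
        3 / 2 * ρ s x / θ s x *
          (Torus.partialDeriv i (Torus.partialDeriv l (fun y => θ s y - θ₁ s y)) x) ^ 2)) := by
  intro σ σ₁ T ρ θ ρ₁ θ₁ u u₁ ζ J hE hE₁ hJ hζ hρJ
  have hU : UniqueDiffOn ℝ (Ico (0 : ℝ) T) := uniqueDiffOn_Ico 0 T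
  refine Torus.IsSmoothSpaceTimeOn.sum fun i _ => Torus.IsSmoothSpaceTimeOn.sum fun l _ => ?_
  exact isSmoothSpaceTimeOn_energyTerm (hE.isSmoothSpaceTimeOn_weightA hJ hζ hρJ) hE.smooth_density
    (hE.isSmoothSpaceTimeOn_weightB)
    (((hE.smooth_density.sub hE₁.smooth_density).partialDeriv hU l).partialDeriv hU i)
    (((hE.smooth_velocity.sub hE₁.smooth_velocity).partialDeriv hU l).partialDeriv hU i)
    (((hE.smooth_temperature.sub hE₁.smooth_temperature).partialDeriv hU l).partialDeriv hU i)

/-- **Level 3.** The density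
`e₃ = Σⱼ Σᵢ Σₗ ½ (A (∂ⱼ∂ᵢ∂ₗδρ)² + ρ ‖∂ⱼ∂ᵢ∂ₗδu‖² + B (∂ⱼ∂ᵢ∂ₗδθ)²)` of `shadowE3` is jointly smooth
on `[0, T) × 𝕋³`. [folklore] -/
theorem isSmoothSpaceTimeOn_shadowDensity3 :
    ∀ {σ σ₁ T : ℝ} {ρ θ ρ₁ θ₁ : ℝ → T3 → ℝ} {u u₁ : ℝ → T3 → V3} {ζ : ℝ → ℝ} {J : Set ℝ},
    IsHardSphereEulerSolution σ T ρ u θ → IsHardSphereEulerSolution σ₁ T ρ₁ u₁ θ₁ → IsOpen J →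
    ContDiffOn ℝ (⊤ : ℕ∞) ζ J → (∀ t ∈ Ico 0 T, ∀ x, ρ t x ∈ J) →
    Torus.IsSmoothSpaceTimeOn (Ico 0 T) (fun s x => ∑ j : Fin 3, ∑ i : Fin 3, ∑ l : Fin 3, 1 / 2 *
      (θ s x * (ζ (ρ s x) + ρ s x * deriv ζ (ρ s x)) / ρ s x *
          (Torus.partialDeriv j (Torus.partialDeriv i (Torus.partialDeriv l
            (fun y => ρ s y - ρ₁ s y))) x) ^ 2 +
        ρ s x * ‖Torus.partialDeriv j (Torus.partialDeriv i (Torus.partialDeriv l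
            (fun y => u s y - u₁ s y))) x‖ ^ 2 +
        3 / 2 * ρ s x / θ s x *
          (Torus.partialDeriv j (Torus.partialDeriv i (Torus.partialDeriv l
            (fun y => θ s y - θ₁ s y))) x) ^ 2)) := by
  intro σ σ₁ T ρ θ ρ₁ θ₁ u u₁ ζ J hE hE₁ hJ hζ hρJ
  have hU : UniqueDiffOn ℝ (Ico (0 : ℝ) T) := uniqueDiffOn_Ico 0 T
  refine Torus.IsSmoothSpaceTimeOn.sum fun j _ => Torus.IsSmoothSpaceTimeOn.sum fun i _ =>
    Torus.IsSmoothSpaceTimeOn.sum fun l _ => ?_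
  exact isSmoothSpaceTimeOn_energyTerm (hE.isSmoothSpaceTimeOn_weightA hJ hζ hρJ) hE.smooth_density
    (hE.isSmoothSpaceTimeOn_weightB)
    ((((hE.smooth_density.sub hE₁.smooth_density).partialDeriv hU l).partialDeriv hU i).partialDeriv
      hU j)
    ((((hE.smooth_velocity.sub hE₁.smooth_velocity).partialDeriv hU l).partialDeriv hU
      i).partialDeriv hU j)
    ((((hE.smooth_temperature.sub hE₁.smooth_temperature).partialDeriv hU l).partialDeriv hU
      i).partialDeriv hU j)

end Densities

/-! ### The same, over the named weights `shadowWeightA/B` and the bodies of `shadowE_k` -/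

section Vocabulary

/-- The weight `shadowWeightA ζ ρ θ = θ (ζ(ρ) + ρ ζ'(ρ)) / ρ` of a σ-solution is jointly smooth on
`[0, T) × 𝕋³` (`isSmoothSpaceTimeOn_weightA`, named form). [folklore] -/
theorem isSmoothSpaceTimeOn_shadowWeightA :
    ∀ {σ T : ℝ} {ρ θ : ℝ → T3 → ℝ} {u : ℝ → T3 → V3} {ζ : ℝ → ℝ} {J : Set ℝ},
    IsHardSphereEulerSolution σ T ρ u θ → IsOpen J → ContDiffOn ℝ (⊤ : ℕ∞) ζ J →
    (∀ t ∈ Ico 0 T, ∀ x, ρ t x ∈ J) → Torus.IsSmoothSpaceTimeOn (Ico 0 T) (shadowWeightA ζ ρ θ) :=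
  fun hE hJ hζ hρJ => hE.isSmoothSpaceTimeOn_weightA hJ hζ hρJ

/-- The weight `shadowWeightB ρ θ = 3ρ/(2θ)` of a σ-solution is jointly smooth on `[0, T) × 𝕋³`
(`isSmoothSpaceTimeOn_weightB`, named form). [folklore] -/
theorem isSmoothSpaceTimeOn_shadowWeightB :
    ∀ {σ T : ℝ} {ρ θ : ℝ → T3 → ℝ} {u : ℝ → T3 → V3},
    IsHardSphereEulerSolution σ T ρ u θ → Torus.IsSmoothSpaceTimeOn (Ico 0 T) (shadowWeightB ρ θ) :=
  fun hE => hE.isSmoothSpaceTimeOn_weightB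

/-- **Level 0, integrand of `shadowE0`** (literally its body): jointly smooth on `[0, T) × 𝕋³`.
[folklore] -/
theorem isSmoothSpaceTimeOn_shadowE0_integrand :
    ∀ {σ σ₁ T : ℝ} {ρ θ ρ₁ θ₁ : ℝ → T3 → ℝ} {u u₁ : ℝ → T3 → V3} {ζ : ℝ → ℝ} {J : Set ℝ},
    IsHardSphereEulerSolution σ T ρ u θ → IsHardSphereEulerSolution σ₁ T ρ₁ u₁ θ₁ → IsOpen J →
    ContDiffOn ℝ (⊤ : ℕ∞) ζ J → (∀ t ∈ Ico 0 T, ∀ x, ρ t x ∈ J) →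
    Torus.IsSmoothSpaceTimeOn (Ico 0 T) (fun s x => 1 / 2 *
      (shadowWeightA ζ ρ θ s x * (ρ s x - ρ₁ s x) ^ 2 + ρ s x * ‖u s x - u₁ s x‖ ^ 2 +
        shadowWeightB ρ θ s x * (θ s x - θ₁ s x) ^ 2)) :=
  fun hE hE₁ hJ hζ hρJ => isSmoothSpaceTimeOn_shadowDensity0 hE hE₁ hJ hζ hρJ

/-- **Level 1, integrand of `shadowE1`** (literally its body): jointly smooth on `[0, T) × 𝕋³`.
[folklore] -/
theorem isSmoothSpaceTimeOn_shadowE1_integrand :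
    ∀ {σ σ₁ T : ℝ} {ρ θ ρ₁ θ₁ : ℝ → T3 → ℝ} {u u₁ : ℝ → T3 → V3} {ζ : ℝ → ℝ} {J : Set ℝ},
    IsHardSphereEulerSolution σ T ρ u θ → IsHardSphereEulerSolution σ₁ T ρ₁ u₁ θ₁ → IsOpen J →
    ContDiffOn ℝ (⊤ : ℕ∞) ζ J → (∀ t ∈ Ico 0 T, ∀ x, ρ t x ∈ J) →
    Torus.IsSmoothSpaceTimeOn (Ico 0 T) (fun s x => ∑ l : Fin 3, 1 / 2 *
      (shadowWeightA ζ ρ θ s x * (Torus.partialDeriv l (fun y => ρ s y - ρ₁ s y) x) ^ 2 +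
        ρ s x * ‖Torus.partialDeriv l (fun y => u s y - u₁ s y) x‖ ^ 2 +
        shadowWeightB ρ θ s x * (Torus.partialDeriv l (fun y => θ s y - θ₁ s y) x) ^ 2)) :=
  fun hE hE₁ hJ hζ hρJ => isSmoothSpaceTimeOn_shadowDensity1 hE hE₁ hJ hζ hρJ

/-- **Level 2, integrand of `shadowE2`** (literally its body): jointly smooth on `[0, T) × 𝕋³`.
[folklore] -/
theorem isSmoothSpaceTimeOn_shadowE2_integrand :
    ∀ {σ σ₁ T : ℝ} {ρ θ ρ₁ θ₁ : ℝ → T3 → ℝ} {u u₁ : ℝ → T3 → V3} {ζ : ℝ → ℝ} {J : Set ℝ},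
    IsHardSphereEulerSolution σ T ρ u θ → IsHardSphereEulerSolution σ₁ T ρ₁ u₁ θ₁ → IsOpen J →
    ContDiffOn ℝ (⊤ : ℕ∞) ζ J → (∀ t ∈ Ico 0 T, ∀ x, ρ t x ∈ J) →
    Torus.IsSmoothSpaceTimeOn (Ico 0 T) (fun s x => ∑ i : Fin 3, ∑ l : Fin 3, 1 / 2 *
      (shadowWeightA ζ ρ θ s x *
          (Torus.partialDeriv i (Torus.partialDeriv l (fun y => ρ s y - ρ₁ s y)) x) ^ 2 +
        ρ s x * ‖Torus.partialDeriv i (Torus.partialDeriv l (fun y => u s y - u₁ s y)) x‖ ^ 2 +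
        shadowWeightB ρ θ s x *
          (Torus.partialDeriv i (Torus.partialDeriv l (fun y => θ s y - θ₁ s y)) x) ^ 2)) :=
  fun hE hE₁ hJ hζ hρJ => isSmoothSpaceTimeOn_shadowDensity2 hE hE₁ hJ hζ hρJ

/-- **Level 3, integrand of `shadowE3`** (literally its body): jointly smooth on `[0, T) × 𝕋³`.
[folklore] -/
theorem isSmoothSpaceTimeOn_shadowE3_integrand :
    ∀ {σ σ₁ T : ℝ} {ρ θ ρ₁ θ₁ : ℝ → T3 → ℝ} {u u₁ : ℝ → T3 → V3} {ζ : ℝ → ℝ} {J : Set ℝ},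
    IsHardSphereEulerSolution σ T ρ u θ → IsHardSphereEulerSolution σ₁ T ρ₁ u₁ θ₁ → IsOpen J →
    ContDiffOn ℝ (⊤ : ℕ∞) ζ J → (∀ t ∈ Ico 0 T, ∀ x, ρ t x ∈ J) →
    Torus.IsSmoothSpaceTimeOn (Ico 0 T) (fun s x => ∑ j : Fin 3, ∑ i : Fin 3, ∑ l : Fin 3, 1 / 2 *
      (shadowWeightA ζ ρ θ s x *
          (Torus.partialDeriv j (Torus.partialDeriv i (Torus.partialDeriv l
            (fun y => ρ s y - ρ₁ s y))) x) ^ 2 +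
        ρ s x * ‖Torus.partialDeriv j (Torus.partialDeriv i (Torus.partialDeriv l
            (fun y => u s y - u₁ s y))) x‖ ^ 2 +
        shadowWeightB ρ θ s x *
          (Torus.partialDeriv j (Torus.partialDeriv i (Torus.partialDeriv l
            (fun y => θ s y - θ₁ s y))) x) ^ 2)) :=
  fun hE hE₁ hJ hζ hρJ => isSmoothSpaceTimeOn_shadowDensity3 hE hE₁ hJ hζ hρJ

end Vocabulary

/-! ### Continuity in time of the level energies -/

section Energies

/-- **Level 0, named energy.** `s ↦ shadowE0 … s = ∫ e₀(s, x) dx` is continuous on `[0, T)`.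
[folklore] -/
theorem continuousOn_shadowE0 :
    ∀ {σ σ₁ T : ℝ} {ρ θ ρ₁ θ₁ : ℝ → T3 → ℝ} {u u₁ : ℝ → T3 → V3} {ζ : ℝ → ℝ} {J : Set ℝ},
    IsHardSphereEulerSolution σ T ρ u θ → IsHardSphereEulerSolution σ₁ T ρ₁ u₁ θ₁ → IsOpen J →
    ContDiffOn ℝ (⊤ : ℕ∞) ζ J → (∀ t ∈ Ico 0 T, ∀ x, ρ t x ∈ J) →
    ContinuousOn (shadowE0 ζ ρ θ u ρ₁ θ₁ u₁) (Ico 0 T) :=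
  fun hE hE₁ hJ hζ hρJ =>
    (isSmoothSpaceTimeOn_shadowE0_integrand hE hE₁ hJ hζ hρJ).continuousOn_integral (convex_Ico _ _)

/-- **Level 1, named energy.** `s ↦ shadowE1 … s = ∫ e₁(s, x) dx` is continuous on `[0, T)`.
[folklore] -/
theorem continuousOn_shadowE1 :
    ∀ {σ σ₁ T : ℝ} {ρ θ ρ₁ θ₁ : ℝ → T3 → ℝ} {u u₁ : ℝ → T3 → V3} {ζ : ℝ → ℝ} {J : Set ℝ},
    IsHardSphereEulerSolution σ T ρ u θ → IsHardSphereEulerSolution σ₁ T ρ₁ u₁ θ₁ → IsOpen J →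
    ContDiffOn ℝ (⊤ : ℕ∞) ζ J → (∀ t ∈ Ico 0 T, ∀ x, ρ t x ∈ J) →
    ContinuousOn (shadowE1 ζ ρ θ u ρ₁ θ₁ u₁) (Ico 0 T) :=
  fun hE hE₁ hJ hζ hρJ =>
    (isSmoothSpaceTimeOn_shadowE1_integrand hE hE₁ hJ hζ hρJ).continuousOn_integral (convex_Ico _ _)

/-- **Level 2, named energy.** `s ↦ shadowE2 … s = ∫ e₂(s, x) dx` is continuous on `[0, T)`.
[folklore] -/
theorem continuousOn_shadowE2 :
    ∀ {σ σ₁ T : ℝ} {ρ θ ρ₁ θ₁ : ℝ → T3 → ℝ} {u u₁ : ℝ → T3 → V3} {ζ : ℝ → ℝ} {J : Set ℝ},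
    IsHardSphereEulerSolution σ T ρ u θ → IsHardSphereEulerSolution σ₁ T ρ₁ u₁ θ₁ → IsOpen J →
    ContDiffOn ℝ (⊤ : ℕ∞) ζ J → (∀ t ∈ Ico 0 T, ∀ x, ρ t x ∈ J) →
    ContinuousOn (shadowE2 ζ ρ θ u ρ₁ θ₁ u₁) (Ico 0 T) :=
  fun hE hE₁ hJ hζ hρJ =>
    (isSmoothSpaceTimeOn_shadowE2_integrand hE hE₁ hJ hζ hρJ).continuousOn_integral (convex_Ico _ _)

/-- **Level 3, named energy.** `s ↦ shadowE3 … s = ∫ e₃(s, x) dx` is continuous on `[0, T)`.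
[folklore] -/
theorem continuousOn_shadowE3 :
    ∀ {σ σ₁ T : ℝ} {ρ θ ρ₁ θ₁ : ℝ → T3 → ℝ} {u u₁ : ℝ → T3 → V3} {ζ : ℝ → ℝ} {J : Set ℝ},
    IsHardSphereEulerSolution σ T ρ u θ → IsHardSphereEulerSolution σ₁ T ρ₁ u₁ θ₁ → IsOpen J →
    ContDiffOn ℝ (⊤ : ℕ∞) ζ J → (∀ t ∈ Ico 0 T, ∀ x, ρ t x ∈ J) →
    ContinuousOn (shadowE3 ζ ρ θ u ρ₁ θ₁ u₁) (Ico 0 T) :=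
  fun hE hE₁ hJ hζ hρJ =>
    (isSmoothSpaceTimeOn_shadowE3_integrand hE hE₁ hJ hζ hρJ).continuousOn_integral (convex_Ico _ _)

end Energies

/-! ### Continuity in time of sup norms -/

section Sup

/-- Pointwise bounds give sup-norm bounds: `‖f x‖ ≤ M` for all `x` (`M ≥ 0`) implies
`(eSupNorm f).toReal ≤ M`. [folklore] -/
theorem toReal_eSupNorm_le_of_forall_norm_le {X F : Type*} [NormedAddCommGroup F] {f : X → F}
    {M : ℝ} (hM : 0 ≤ M) (h : ∀ x, ‖f x‖ ≤ M) : (eSupNorm f).toReal ≤ M :=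
  ENNReal.toReal_le_of_le_ofReal hM (iSup_le fun x => by
    rw [← ofReal_norm]
    exact ENNReal.ofReal_le_ofReal (h x))

/-- **Sup-in-time continuity, scalar fields.** For a jointly smooth scalar field `φ` on
`[0, T) × 𝕋³`, the sup norm `g(s) = ‖φ s‖_∞ = (eSupNorm (φ s)).toReal` is continuous on `[0, T)`
(tube lemma over the compact torus; `Torus.IsSmoothSpaceTimeOn.continuousOn_toReal_eSupNorm`),
dominates `|φ s x|` for `s ∈ [0, T)` (`Torus.norm_le_toReal_eSupNorm`), and is the LEAST such
bound: `|φ s x| ≤ M` for all `x` (`M ≥ 0`) gives `g(s) ≤ M`. [folklore] -/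
theorem shadow_sup_continuous :
    ∀ {T : ℝ} {φ : ℝ → T3 → ℝ}, Torus.IsSmoothSpaceTimeOn (Ico 0 T) φ →
    ContinuousOn (fun s => (eSupNorm (φ s)).toReal) (Ico 0 T) ∧
      (∀ s ∈ Ico 0 T, ∀ x, |φ s x| ≤ (eSupNorm (φ s)).toReal) ∧
      ∀ (s M : ℝ), 0 ≤ M → (∀ x, |φ s x| ≤ M) → (eSupNorm (φ s)).toReal ≤ M := by
  intro T φ hφ
  refine ⟨hφ.continuousOn_toReal_eSupNorm, fun s hs x => ?_, fun s M hM h => ?_⟩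
  · rw [← Real.norm_eq_abs]
    exact Torus.norm_le_toReal_eSupNorm (hφ.isSmooth_slice hs).continuous x
  · exact toReal_eSupNorm_le_of_forall_norm_le hM fun x => (Real.norm_eq_abs _).trans_le (h x)

/-- **Sup-in-time continuity, vector fields.** For a jointly smooth `V3`-valued field `w` on
`[0, T) × 𝕋³`, the sup norm `g(s) = ‖w s‖_∞ = (eSupNorm (w s)).toReal` is continuous on `[0, T)`,
dominates `‖w s x‖` for `s ∈ [0, T)`, and `‖w s x‖ ≤ M` for all `x` (`M ≥ 0`) gives `g(s) ≤ M`.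
[folklore] -/
theorem shadow_sup_continuous_vec :
    ∀ {T : ℝ} {w : ℝ → T3 → V3}, Torus.IsSmoothSpaceTimeOn (Ico 0 T) w →
    ContinuousOn (fun s => (eSupNorm (w s)).toReal) (Ico 0 T) ∧
      (∀ s ∈ Ico 0 T, ∀ x, ‖w s x‖ ≤ (eSupNorm (w s)).toReal) ∧
      ∀ (s M : ℝ), 0 ≤ M → (∀ x, ‖w s x‖ ≤ M) → (eSupNorm (w s)).toReal ≤ M := by
  intro T w hw
  exact ⟨hw.continuousOn_toReal_eSupNorm, fun s hs x =>
    Torus.norm_le_toReal_eSupNorm (hw.isSmooth_slice hs).continuous x, fun s M hM h =>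
    toReal_eSupNorm_le_of_forall_norm_le hM h⟩

end Sup

/-! ## The lift of a partial derivative: one Fréchet order down -/

/-- **Shift lemma**: for smooth `f : 𝕋³ → F`, `‖Dᵏ((∂ᵢf) ∘ proj)(y)‖ ≤ ‖Dᵏ⁺¹(f ∘ proj)(y)‖`
(the lift of `∂ᵢf` is `y ↦ D(f∘proj)(y)[eᵢ]`, `‖eᵢ‖ = 1`; Mathlib `norm_iteratedFDeriv_clm_apply_const`,
`norm_iteratedFDeriv_fderiv`). [folklore] -/
theorem torus_norm_iteratedFDeriv_lift_partialDeriv_le :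
    ∀ {F : Type} [NormedAddCommGroup F] [NormedSpace ℝ F] {f : T3 → F}, Torus.IsSmooth f →
      ∀ (i : Fin 3) (k : ℕ) (y : EuclideanSpace ℝ (Fin 3)),
        ‖iteratedFDeriv ℝ k (Torus.lift (Torus.partialDeriv i f)) y‖ ≤
          ‖iteratedFDeriv ℝ (k + 1) (Torus.lift f) y‖ := by
  intro F _ _ f hf i k y
  have h1 : Torus.IsContDiff 1 f := hf.isContDiff (by simp)
  have hl : Torus.lift (Torus.partialDeriv i f) =
      fun y => fderiv ℝ (Torus.lift f) y (EuclideanSpace.single i (1 : ℝ)) :=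
    Torus.lift_lineDeriv h1 _
  rw [hl]
  have hD : ContDiff ℝ k (fderiv ℝ (Torus.lift f)) := hf.fderiv_right (m := k) (by exact_mod_cast le_top)
  calc ‖iteratedFDeriv ℝ k (fun y => fderiv ℝ (Torus.lift f) y (EuclideanSpace.single i (1 : ℝ))) y‖
      ≤ ‖(EuclideanSpace.single i (1 : ℝ) : EuclideanSpace ℝ (Fin 3))‖ *
          ‖iteratedFDeriv ℝ k (fderiv ℝ (Torus.lift f)) y‖ :=
        norm_iteratedFDeriv_clm_apply_const hD.contDiffAt (by exact_mod_cast le_rfl)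
    _ = ‖iteratedFDeriv ℝ (k + 1) (Torus.lift f) y‖ := by
        rw [norm_iteratedFDeriv_fderiv, EuclideanSpace.single, PiLp.norm_single, norm_one, one_mul]

/-- **Iterated shift**: `‖Dᵏ((∂^l f) ∘ proj)(y)‖ ≤ ‖D^{k+|l|}(f ∘ proj)(y)‖` for the iterated partial
derivative along a list `l` of directions. [folklore] -/
theorem torus_norm_iteratedFDeriv_lift_iterPartialDeriv_le :
    ∀ {F : Type} [NormedAddCommGroup F] [NormedSpace ℝ F] {f : T3 → F}, Torus.IsSmooth f →
      ∀ (l : List (Fin 3)) (k : ℕ) (y : EuclideanSpace ℝ (Fin 3)),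
        ‖iteratedFDeriv ℝ k (Torus.lift (Torus.iterPartialDeriv l f)) y‖ ≤
          ‖iteratedFDeriv ℝ (k + l.length) (Torus.lift f) y‖ := by
  intro F _ _ f hf l
  induction l with
  | nil => intro k y; simp
  | cons i l ih =>
    intro k y
    rw [Torus.iterPartialDeriv_cons, List.length_cons]
    calc ‖iteratedFDeriv ℝ k (Torus.lift (Torus.partialDeriv i (Torus.iterPartialDeriv l f))) y‖
        ≤ ‖iteratedFDeriv ℝ (k + 1) (Torus.lift (Torus.iterPartialDeriv l f)) y‖ :=
          torus_norm_iteratedFDeriv_lift_partialDeriv_le (hf.iterPartialDeriv l) i k y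
      _ ≤ ‖iteratedFDeriv ℝ (k + 1 + l.length) (Torus.lift f) y‖ := ih (k + 1) y
      _ = ‖iteratedFDeriv ℝ (k + (l.length + 1)) (Torus.lift f) y‖ := by rw [add_assoc, add_comm 1]

/-- **Read-out**: `‖∂^l f(proj y)‖ ≤ ‖D^{|l|}(f ∘ proj)(y)‖`. [folklore] -/
theorem torus_norm_iterPartialDeriv_le_norm_iteratedFDeriv_lift :
    ∀ {F : Type} [NormedAddCommGroup F] [NormedSpace ℝ F] {f : T3 → F}, Torus.IsSmooth f →
      ∀ (l : List (Fin 3)) (y : EuclideanSpace ℝ (Fin 3)),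
        ‖Torus.iterPartialDeriv l f (Torus.proj y)‖ ≤ ‖iteratedFDeriv ℝ l.length (Torus.lift f) y‖ := by
  intro F _ _ f hf l y
  have h := torus_norm_iteratedFDeriv_lift_iterPartialDeriv_le hf l 0 y
  rwa [norm_iteratedFDeriv_zero, Torus.lift_apply, zero_add] at h

/-- **Sup form**: a uniform bound `B` on `‖Dⁿ(f ∘ proj)‖` bounds every iterated partial derivative of
order `n` everywhere on the torus. [folklore] -/
theorem torus_norm_iterPartialDeriv_le_of_lift_bound :
    ∀ {F : Type} [NormedAddCommGroup F] [NormedSpace ℝ F] {f : T3 → F}, Torus.IsSmooth f →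
      ∀ {n : ℕ} {B : ℝ}, (∀ y : EuclideanSpace ℝ (Fin 3), ‖iteratedFDeriv ℝ n (Torus.lift f) y‖ ≤ B) →
      ∀ (l : List (Fin 3)), l.length = n → ∀ x : T3, ‖Torus.iterPartialDeriv l f x‖ ≤ B := by
  intro F _ _ f hf n B hB l hl x
  obtain ⟨y, rfl⟩ := Torus.proj_surjective x
  exact (torus_norm_iterPartialDeriv_le_norm_iteratedFDeriv_lift hf l y).trans (hl ▸ hB y)

/-- **Lift → torus bridge, orders `1–4`, real-valued** (registered helper): if
`‖Dⁿ(f ∘ proj)‖ ≤ M n` for all `n ≤ 4` then `|∂ᵢf| ≤ M 1`, `|∂ᵢ∂ⱼf| ≤ M 2`, `|∂ᵢ∂ⱼ∂ₖf| ≤ M 3`,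
`|∂ᵢ∂ⱼ∂ₖ∂ₗf| ≤ M 4` everywhere (nested `Torus.partialDeriv` spelling of `shadowE2`/`shadowE3`). [folklore] -/
theorem torus_partialDeriv_iter_le_of_lift_bounds :
    ∀ {f : T3 → ℝ}, Torus.IsSmooth f → ∀ {M : ℕ → ℝ},
      (∀ n : ℕ, n ≤ 4 → ∀ y : EuclideanSpace ℝ (Fin 3), ‖iteratedFDeriv ℝ n (Torus.lift f) y‖ ≤ M n) →
      ∀ (x : T3) (i j k l : Fin 3),
        |Torus.partialDeriv i f x| ≤ M 1 ∧
        |Torus.partialDeriv i (Torus.partialDeriv j f) x| ≤ M 2 ∧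
        |Torus.partialDeriv i (Torus.partialDeriv j (Torus.partialDeriv k f)) x| ≤ M 3 ∧
        |Torus.partialDeriv i (Torus.partialDeriv j (Torus.partialDeriv k (Torus.partialDeriv l f))) x| ≤
          M 4 := by
  intro f hf M hM x i j k l
  refine ⟨?_, ?_, ?_, ?_⟩
  · simpa using torus_norm_iterPartialDeriv_le_of_lift_bound hf (hM 1 (by norm_num)) [i] rfl x
  · simpa using torus_norm_iterPartialDeriv_le_of_lift_bound hf (hM 2 (by norm_num)) [i, j] rfl x
  · simpa using torus_norm_iterPartialDeriv_le_of_lift_bound hf (hM 3 (by norm_num)) [i, j, k] rfl x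
  · simpa using torus_norm_iterPartialDeriv_le_of_lift_bound hf (hM 4 (by norm_num)) [i, j, k, l] rfl x

/-- **Components cost nothing**: `‖Dⁿ((x ↦ u x c) ∘ proj)(y)‖ ≤ ‖Dⁿ(u ∘ proj)(y)‖` for a smooth
`V3`-valued field (`‖proj_c‖ ≤ 1`). [folklore] -/
theorem torus_norm_iteratedFDeriv_lift_coord_le :
    ∀ {u : T3 → V3}, Torus.IsSmooth u → ∀ (c : Fin 3) (n : ℕ) (y : EuclideanSpace ℝ (Fin 3)),
      ‖iteratedFDeriv ℝ n (Torus.lift (fun x => u x c)) y‖ ≤ ‖iteratedFDeriv ℝ n (Torus.lift u) y‖ := by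
  intro u hu c n y
  have hl : Torus.lift (fun x => u x c) = (EuclideanSpace.proj c : V3 →L[ℝ] ℝ) ∘ Torus.lift u := rfl
  rw [hl]
  refine ((EuclideanSpace.proj c : V3 →L[ℝ] ℝ).norm_iteratedFDeriv_comp_left hu.contDiffAt
    (by exact_mod_cast le_top)).trans ?_
  have hn : ‖(EuclideanSpace.proj c : V3 →L[ℝ] ℝ)‖ ≤ 1 := by
    refine ContinuousLinearMap.opNorm_le_bound _ zero_le_one fun v => ?_
    rw [one_mul]
    exact PiLp.norm_apply_le v c
  calc ‖(EuclideanSpace.proj c : V3 →L[ℝ] ℝ)‖ * ‖iteratedFDeriv ℝ n (Torus.lift u) y‖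
      ≤ 1 * ‖iteratedFDeriv ℝ n (Torus.lift u) y‖ := mul_le_mul_of_nonneg_right hn (norm_nonneg _)
    _ = _ := one_mul _

/-- **Lift → torus bridge for `V3`-valued fields, orders `0–4`**: the field, its nested partial
derivatives (in the `V3` norm) and those of every component `x ↦ u x c` are bounded by `M n`. [folklore] -/
theorem torus_partialDeriv_iter_le_of_lift_bounds_vec :
    ∀ {u : T3 → V3}, Torus.IsSmooth u → ∀ {M : ℕ → ℝ},
      (∀ n : ℕ, n ≤ 4 → ∀ y : EuclideanSpace ℝ (Fin 3), ‖iteratedFDeriv ℝ n (Torus.lift u) y‖ ≤ M n) →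
      ∀ (x : T3) (i j k l c : Fin 3),
        (‖u x‖ ≤ M 0 ∧ ‖Torus.partialDeriv i u x‖ ≤ M 1 ∧
          ‖Torus.partialDeriv i (Torus.partialDeriv j u) x‖ ≤ M 2 ∧
          ‖Torus.partialDeriv i (Torus.partialDeriv j (Torus.partialDeriv k u)) x‖ ≤ M 3 ∧
          ‖Torus.partialDeriv i (Torus.partialDeriv j (Torus.partialDeriv k (Torus.partialDeriv l u))) x‖ ≤
            M 4) ∧
        (|u x c| ≤ M 0 ∧ |Torus.partialDeriv i (fun y => u y c) x| ≤ M 1 ∧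
          |Torus.partialDeriv i (Torus.partialDeriv j (fun y => u y c)) x| ≤ M 2 ∧
          |Torus.partialDeriv i (Torus.partialDeriv j (Torus.partialDeriv k (fun y => u y c))) x| ≤ M 3 ∧
          |Torus.partialDeriv i (Torus.partialDeriv j (Torus.partialDeriv k
            (Torus.partialDeriv l (fun y => u y c)))) x| ≤ M 4) := by
  intro u hu M hM x i j k l c
  have huc : Torus.IsSmooth (fun y => u y c) := hu.apply c
  have hMc : ∀ n : ℕ, n ≤ 4 → ∀ y : EuclideanSpace ℝ (Fin 3),
      ‖iteratedFDeriv ℝ n (Torus.lift (fun x => u x c)) y‖ ≤ M n :=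
    fun n hn y => (torus_norm_iteratedFDeriv_lift_coord_le hu c n y).trans (hM n hn y)
  refine ⟨⟨?_, ?_, ?_, ?_, ?_⟩, ?_, ?_, ?_, ?_, ?_⟩
  · simpa using torus_norm_iterPartialDeriv_le_of_lift_bound hu (hM 0 (by norm_num)) [] rfl x
  · simpa using torus_norm_iterPartialDeriv_le_of_lift_bound hu (hM 1 (by norm_num)) [i] rfl x
  · simpa using torus_norm_iterPartialDeriv_le_of_lift_bound hu (hM 2 (by norm_num)) [i, j] rfl x
  · simpa using torus_norm_iterPartialDeriv_le_of_lift_bound hu (hM 3 (by norm_num)) [i, j, k] rfl x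
  · simpa using torus_norm_iterPartialDeriv_le_of_lift_bound hu (hM 4 (by norm_num)) [i, j, k, l] rfl x
  · simpa using torus_norm_iterPartialDeriv_le_of_lift_bound huc (hMc 0 (by norm_num)) [] rfl x
  · simpa using torus_norm_iterPartialDeriv_le_of_lift_bound huc (hMc 1 (by norm_num)) [i] rfl x
  · simpa using torus_norm_iterPartialDeriv_le_of_lift_bound huc (hMc 2 (by norm_num)) [i, j] rfl x
  · simpa using torus_norm_iterPartialDeriv_le_of_lift_bound huc (hMc 3 (by norm_num)) [i, j, k] rfl x
  · simpa using torus_norm_iterPartialDeriv_le_of_lift_bound huc (hMc 4 (by norm_num)) [i, j, k, l] rfl x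

end HsEulerStability

end Literature.MathematicalPhysics.KineticTheory

end
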